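import Summits.Ventures.PercRepro.DominantClass

/-!
# Lemma B in the near-dominant regime, modulo the Marica–Schönheim equality structure

`DominantClass.lean` settles Lemma B when a column dominates (`crossCount ≤ columnCount i`). The
next regime is `crossCount ≤ columnCount i + 1`: at most ONE bad pair avoids the cell `x i`. This
file reduces it to a single classical-looking statement about set families:

* `MSTightNoSplit` — **a Marica–Schönheim-tight family cannot be split**: if `|F \\ F| = |F|`
  (equality in Marica–Schönheim, Mathlib `Finset.card_le_card_diffs`) then `F` cannot be written
  as `s ⊔ t` with `s, t` nonempty and no member of `s` comparable to a member of `t` (the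
  comparability graph of `F` is connected). Exhaustively TRUE for every family of nonempty subsets
  of `[4]` with `|F| ≤ 8` and of `[5]` with `|F| ≤ 7` (p4 gen 8, mining/p4/g8/ms, local + kit
  j185388); the equality cases of Marica–Schönheim were characterised by Aharoni–Holzman (J. London
  Math. Soc. 48 (1993) 385–398; not held in the cell's corpus). A typed CANDIDATE Prop, never
  asserted; `(ST)` in proofs/P4-gen8.md §4.

With it: if Lemma B failed, Marica–Schönheim on the column `C_i` would be TIGHT
(`columnCount i ≤ |C_i \\ C_i| ≤ topBotCount < crossCount ≤ columnCount i + 1`); the column splits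
into the two classes `crossFam i j₁`, `crossFam i j₂` (complement cells `x j₁`, `x j₂`), and a
comparable pair across them forces `x j₂ ≤ x j₁`, impossible in a crossing family with a third
cell; so one class is empty and the column of the other complement cell dominates
(`crossCount_le_topBotCount_of_le_columnCount`). Hence
`crossCount_le_topBotCount_of_le_columnCount_add_one`: for three crossing cells,
`crossCount ≤ columnCount i + 1 → crossCount ≤ topBotCount` — for EVERY monotone map, no
single-merge hypothesis.
-/

namespace PercRepro

open Finset
open scoped FinsetFamily

/-- **CANDIDATE (ST): a Marica–Schönheim-tight family cannot be split.** For finsets `s, t` of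
configurations, nonempty and disjoint, with `|(s ∪ t) \\ (s ∪ t)| = |s ∪ t|`, some member of `s` is
comparable to some member of `t`. Typed hypothesis; exhaustive evidence for `n ≤ 5` (see the
module docstring); never asserted. -/
def MSTightNoSplit : Prop :=
  ∀ {S : Type} [Fintype S] [DecidableEq S] (s t : Finset (Config S)), s.Nonempty → t.Nonempty →
    Disjoint s t → ((s ∪ t) \\ (s ∪ t)).card = (s ∪ t).card →
      ∃ a ∈ s, ∃ b ∈ t, a ≤ b ∨ b ≤ a

section NearDominant

variable {S : Type} [Fintype S] [DecidableEq S] {k r : ℕ} (x : Fin r → Setoid (Fin k))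
  (c : Config S → Setoid (Fin k))

/-- In a crossing family with three pairwise distinct cells `x i, x j₁, x j₂`, the cell `x j₂` is
not below `x j₁` (else `x j₂ = ⊥`, `x j₁ = ⊤` and `x i = x i ⊓ x j₁ = ⊥ = x j₂`). -/
theorem not_le_of_crossing (hx : IsCrossingFamily x) {i j₁ j₂ : Fin r} (hij₁ : i ≠ j₁)
    (hij₂ : i ≠ j₂) (hj : j₁ ≠ j₂) (hle : x j₂ ≤ x j₁) : False := by
  have h1 : x j₂ = ⊥ := by
    rw [← hx.inf_eq_bot hj.symm]
    exact (inf_eq_left.2 hle).symm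
  have h2 : x j₁ = ⊤ := by
    rw [← hx.sup_eq_top hj]
    exact (sup_eq_left.2 hle).symm
  have h3 : x i = ⊥ := by
    have := hx.inf_eq_bot hij₁
    rw [h2, inf_top_eq] at this
    exact this
  exact hij₂ (hx.injective (h3.trans h1.symm))

/-- Two crossing classes of the same cell with different complement cells are disjoint. -/
theorem disjoint_crossFam_of_ne (hx : Function.Injective x) (i : Fin r) {j₁ j₂ : Fin r}
    (hj : j₁ ≠ j₂) : Disjoint (crossFam x c i j₁) (crossFam x c i j₂) := by
  rw [Finset.disjoint_left]
  intro ω h1 h2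
  obtain ⟨-, -, e1⟩ := (mem_crossFam x c).1 h1
  obtain ⟨-, -, e2⟩ := (mem_crossFam x c).1 h2
  exact hj (hx (e1.symm.trans e2))

open Classical in
/-- The column of cell `i` is the union of its two classes when `univ.erase i = {j₁, j₂}`. -/
theorem columnSet_eq_union (i j₁ j₂ : Fin r) (h : Finset.univ.erase i = {j₁, j₂}) :
    columnSet x c i = crossFam x c i j₁ ∪ crossFam x c i j₂ := by
  rw [columnSet_eq_biUnion, h, Finset.biUnion_insert, Finset.singleton_biUnion]

open Classical in
/-- A comparable pair across the two classes of a column is impossible (three distinct cells). -/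
theorem not_comparable_across (hx : IsCrossingFamily x) (hc : Monotone c) {i j₁ j₂ : Fin r}
    (hij₁ : i ≠ j₁) (hij₂ : i ≠ j₂) (hj : j₁ ≠ j₂) {a b : Config S} (ha : a ∈ crossFam x c i j₁)
    (hb : b ∈ crossFam x c i j₂) (hab : a ≤ b ∨ b ≤ a) : False := by
  obtain ⟨-, -, ea⟩ := (mem_crossFam x c).1 ha
  obtain ⟨-, -, eb⟩ := (mem_crossFam x c).1 hb
  rcases hab with hab | hab
  · -- `a ≤ b` gives `bᶜ ≤ aᶜ`, so `x j₂ = c bᶜ ≤ c aᶜ = x j₁`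
    have : x j₂ ≤ x j₁ := by
      rw [← ea, ← eb]
      exact hc (compl_le_compl hab)
    exact not_le_of_crossing x hx hij₁ hij₂ hj this
  · have : x j₁ ≤ x j₂ := by
      rw [← ea, ← eb]
      exact hc (compl_le_compl hab)
    exact not_le_of_crossing x hx hij₂ hij₁ hj.symm this

open Classical in
/-- Marica–Schönheim on a column, the difference count in the middle:
`columnCount i ≤ |C_i \\ C_i| ≤ topBotCount` (the two halves of `columnCount_le_topBotCount`). -/
theorem card_diffs_columnSet_le_topBotCount (hx : IsCrossingFamily x) (hc : Monotone c)
    (i : Fin r) : (columnSet x c i \\ columnSet x c i).card ≤ topBotCount c := by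
  rw [← Finset.card_image_of_injective (columnSet x c i \\ columnSet x c i) compl_injective]
  refine Finset.card_le_card ?_
  intro D hD
  obtain ⟨D', hD', rfl⟩ := Finset.mem_image.1 hD
  obtain ⟨A, hA, B, hB, rfl⟩ := Finset.mem_diffs.1 hD'
  exact compl_sdiff_mem_goodSet x c hx hc hA hB

open Classical in
/-- **The near-dominant step for an explicit column** `i` with the other two cells `j₁, j₂`
(`univ.erase i = {j₁, j₂}`), given the three-cell bookkeeping identities: if at most one bad pair
avoids cell `i`, Lemma B holds — modulo `MSTightNoSplit`. -/
theorem crossCount_le_topBotCount_of_columns (hST : MSTightNoSplit) (hx : IsCrossingFamily x)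
    (hc : Monotone c) {i j₁ j₂ : Fin r} (hij₁ : i ≠ j₁) (hij₂ : i ≠ j₂) (hj : j₁ ≠ j₂)
    (huniv : Finset.univ.erase i = {j₁, j₂})
    (hcol₁ : columnCount x c j₁ = (crossFam x c j₁ i).card + (crossFam x c j₁ j₂).card)
    (hcol₂ : columnCount x c j₂ = (crossFam x c j₂ i).card + (crossFam x c j₂ j₁).card)
    (hsum : crossCount x c =
      (crossFam x c i j₁).card + (crossFam x c i j₂).card + (crossFam x c j₁ j₂).card)
    (h : crossCount x c ≤ columnCount x c i + 1) : crossCount x c ≤ topBotCount c := by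
  by_contra hlt
  push Not at hlt
  -- Marica–Schönheim on column `i` is tight
  have hms1 : columnCount x c i ≤ (columnSet x c i \\ columnSet x c i).card :=
    Finset.card_le_card_diffs _
  have hms2 := card_diffs_columnSet_le_topBotCount x c hx hc i
  have htight : ((crossFam x c i j₁ ∪ crossFam x c i j₂) \\
      (crossFam x c i j₁ ∪ crossFam x c i j₂)).card =
      (crossFam x c i j₁ ∪ crossFam x c i j₂).card := by
    rw [← columnSet_eq_union x c i j₁ j₂ huniv]
    change _ = columnCount x c i
    omega
  by_cases h1 : (crossFam x c i j₁).Nonempty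
  · by_cases h2 : (crossFam x c i j₂).Nonempty
    · -- both classes present: a comparable pair across them, impossible
      obtain ⟨a, ha, b, hb, hab⟩ :=
        hST _ _ h1 h2 (disjoint_crossFam_of_ne x c hx.injective i hj) htight
      exact not_comparable_across x c hx hc hij₁ hij₂ hj ha hb hab
    · -- no `(x i, x j₂)` pair: the column of `x j₁` dominates
      have hz : (crossFam x c i j₂).card = 0 := by
        rw [Finset.card_eq_zero, ← Finset.not_nonempty_iff_eq_empty]; exact h2
      have hdom : crossCount x c ≤ columnCount x c j₁ := by
        rw [hcol₁, card_crossFam_comm x c j₁ i]; omega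
      exact absurd (crossCount_le_topBotCount_of_le_columnCount x c hx hc j₁ hdom) (not_le.2 hlt)
  · -- no `(x i, x j₁)` pair: the column of `x j₂` dominates
    have hz : (crossFam x c i j₁).card = 0 := by
      rw [Finset.card_eq_zero, ← Finset.not_nonempty_iff_eq_empty]; exact h1
    have hdom : crossCount x c ≤ columnCount x c j₂ := by
      rw [hcol₂, card_crossFam_comm x c j₂ i, card_crossFam_comm x c j₂ j₁]; omega
    exact absurd (crossCount_le_topBotCount_of_le_columnCount x c hx hc j₂ hdom) (not_le.2 hlt)

/-- A sum over `univ.erase j` in `Fin 3` is the sum over the other two indices. -/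
theorem sum_erase_fin3 (f : Fin 3 → ℕ) {j a b : Fin 3} (h : Finset.univ.erase j = {a, b})
    (hab : a ≠ b) : ∑ j' ∈ Finset.univ.erase j, f j' = f a + f b := by
  rw [h, Finset.sum_pair hab]

open Classical in
/-- For three cells, `crossCount` is the sum of the three class sizes `|F₀₁| + |F₀₂| + |F₁₂|`. -/
theorem crossCount_eq_three (x : Fin 3 → Setoid (Fin k)) (hx : Function.Injective x) :
    crossCount x c = (crossFam x c 0 1).card + (crossFam x c 0 2).card +
      (crossFam x c 1 2).card := by
  rw [crossCount_eq_sum x c hx]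
  simp only [Fin.sum_univ_three, Fin.isValue]
  simp [Fin.lt_def]

end NearDominant

section Three

variable {S : Type} [Fintype S] [DecidableEq S] {k : ℕ} (x : Fin 3 → Setoid (Fin k))
  (c : Config S → Setoid (Fin k))

open Classical in
/-- **Lemma B in the near-dominant regime, modulo `MSTightNoSplit`**: for three crossing cells and
a monotone map, if at most one bad pair avoids the cell `x i` (`crossCount ≤ columnCount i + 1`),
then `crossCount ≤ topBotCount`. -/
theorem crossCount_le_topBotCount_of_le_columnCount_add_one (hST : MSTightNoSplit)
    (hx : IsCrossingFamily x) (hc : Monotone c) (i : Fin 3)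
    (h : crossCount x c ≤ columnCount x c i + 1) : crossCount x c ≤ topBotCount c := by
  have hbase := crossCount_eq_three c x hx.injective
  have hcol : ∀ j : Fin 3, columnCount x c j =
      ∑ j' ∈ Finset.univ.erase j, (crossFam x c j j').card :=
    fun j => columnCount_eq_sum x c hx.injective j
  fin_cases i
  · refine crossCount_le_topBotCount_of_columns x c hST hx hc (i := 0) (j₁ := 1) (j₂ := 2)
      (by decide) (by decide) (by decide) (by decide) ?_ ?_ ?_ h
    · rw [hcol 1, sum_erase_fin3 _ (j := 1) (a := 0) (b := 2) (by decide) (by decide)]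
    · rw [hcol 2, sum_erase_fin3 _ (j := 2) (a := 0) (b := 1) (by decide) (by decide)]
    · exact hbase
  · refine crossCount_le_topBotCount_of_columns x c hST hx hc (i := 1) (j₁ := 0) (j₂ := 2)
      (by decide) (by decide) (by decide) (by decide) ?_ ?_ ?_ h
    · rw [hcol 0, sum_erase_fin3 _ (j := 0) (a := 1) (b := 2) (by decide) (by decide)]
    · rw [hcol 2, sum_erase_fin3 _ (j := 2) (a := 1) (b := 0) (by decide) (by decide)]
    · rw [hbase, card_crossFam_comm x c 1 0]; ring
  · refine crossCount_le_topBotCount_of_columns x c hST hx hc (i := 2) (j₁ := 0) (j₂ := 1)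
      (by decide) (by decide) (by decide) (by decide) ?_ ?_ ?_ h
    · rw [hcol 0, sum_erase_fin3 _ (j := 0) (a := 2) (b := 1) (by decide) (by decide)]
    · rw [hcol 1, sum_erase_fin3 _ (j := 1) (a := 2) (b := 0) (by decide) (by decide)]
    · rw [hbase, card_crossFam_comm x c 2 0, card_crossFam_comm x c 2 1]; ring

/-- **Lemma B for `cross4` in the near-dominant regime, modulo `MSTightNoSplit`**: at most one
antipodal pair of some type `{x j₁, x j₂}` ⇒ `crossCount cross4 c ≤ topBotCount c`. -/
theorem lemmaB_cross4_of_le_columnCount_add_one (hST : MSTightNoSplit)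
    (c : Config S → Setoid (Fin 4)) (hc : Monotone c) (i : Fin 3)
    (h : crossCount cross4 c ≤ columnCount cross4 c i + 1) : crossCount cross4 c ≤ topBotCount c :=
  crossCount_le_topBotCount_of_le_columnCount_add_one cross4 c hST cross4_isCrossingFamily hc i h

end Three



end PercRepro
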